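import Literature.Analysis.FluidPDE.StatisticalSolution
import Literature.Analysis.FluidPDE.CylindricalGenerator
import Literature.Analysis.FunctionSpaces.TorusFourierCalculus
import Literature.Analysis.FunctionSpaces.TorusEnstrophyOrthogonality
import Literature.Analysis.FunctionSpaces.TorusTestFunction
import Literature.Analysis.FunctionSpaces.TorusVectorParseval
import Literature.Analysis.FunctionSpaces.TorusSpectralWeakDerivative

/-!
# Order-3 surgery for `MomentParity.QuarticGate` (stmt-AnomalousDissipation-11464), helper VIII:
# the enstrophy of a finite combination of smooth fields is a quadratic polynomial ("Enstrophy")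

Support file for the stub `stub_order3Surgery` of the line `recession-cone` (S5): the
DISSIPATION input of the assembly (shape of infrastructure I5). For smooth fields `b₁,…,bₙ` on
`T³` there is a polynomial `D` of degree `≤ 2` in `n` variables with
`‖∇v‖₂² = D(x)` for every field `v` that agrees a.e. with `Σᵢ xᵢ bᵢ`
(`exists_gradNormSq_poly`): the spectral enstrophy `Torus.eGradNormSq` only sees the a.e. class
(`eGradNormSq_congr_ae`), on smooth fields it is the classical `∫ Σⱼ ‖∂ⱼ·‖²`
(`Torus.eGradNormSq_eq_ofReal_gradNormSq`), and the latter is the quadratic form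
`Σᵢᵢ' xᵢ xᵢ' ∫ Σⱼ ⟪∂ⱼ bᵢ, ∂ⱼ bᵢ'⟫` (`gradNormSq_sum_smul`).
-/

-- `Summit.<Summit>.<Problem>` is the tree's mandated summit-side namespace (CONVENTIONS §2); for this
-- single-conjunct summit the two coincide, so the duplicate is deliberate.
set_option linter.dupNamespace false

namespace Summit.AnomalousDissipation.AnomalousDissipation.Theorems.MomentParityQuarticGate

open scoped BigOperators InnerProductSpace RealInnerProductSpace ENNReal
open MeasureTheory MvPolynomial
open Literature.Analysis.FunctionSpaces Literature.Analysis.FluidPDE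

/-- The spectral enstrophy only depends on the a.e. class of the field. [folklore] -/
theorem eGradNormSq_congr_ae {v w : UnitAddTorus (Fin 3) → EuclideanSpace ℝ (Fin 3)}
    (h : v =ᵐ[volume] w) : Torus.eGradNormSq v = Torus.eGradNormSq w := by
  rw [Torus.eGradNormSq_eq_tsum, Torus.eGradNormSq_eq_tsum]
  congr 1
  refine tsum_congr fun k => ?_
  have h' : (EuclideanSpace.complexify ∘ v : UnitAddTorus (Fin 3) → EuclideanSpace ℂ (Fin 3)) =ᵐ[volume]
      (EuclideanSpace.complexify ∘ w) := h.mono fun x hx => by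
    show EuclideanSpace.complexify (v x) = EuclideanSpace.complexify (w x)
    rw [hx]
  rw [Torus.mFourierCoeff_congr_ae h' k]

/-- Partial derivatives of a finite combination of smooth fields. [folklore] -/
theorem partialDeriv_sum_smul {n : ℕ} {b : Fin n → UnitAddTorus (Fin 3) → EuclideanSpace ℝ (Fin 3)}
    (hb : ∀ i, Torus.IsSmooth (b i)) (x : Fin n → ℝ) (j : Fin 3) (y : UnitAddTorus (Fin 3)) :
    Torus.partialDeriv j (fun z => ∑ i, x i • b i z) y = ∑ i, x i • Torus.partialDeriv j (b i) y := by
  have h1 : ∀ i, Torus.IsContDiff 1 (b i) := fun i => (hb i).isContDiff (by exact_mod_cast le_top)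
  rw [Torus.partialDeriv_finset_sum Finset.univ (f := fun i z => x i • b i z)
    (fun i _ => (h1 i).smul (x i)) j y]
  refine Finset.sum_congr rfl fun i _ => ?_
  exact congr_fun (Torus.partialDeriv_const_smul (h1 i) (x i) j) y

/-- **The classical enstrophy of `Σᵢ xᵢ bᵢ` is a quadratic form in `x`.** [folklore] -/
theorem gradNormSq_sum_smul {n : ℕ} {b : Fin n → UnitAddTorus (Fin 3) → EuclideanSpace ℝ (Fin 3)}
    (hb : ∀ i, Torus.IsSmooth (b i)) (x : Fin n → ℝ) :
    Torus.gradNormSq (fun z => ∑ i, x i • b i z) =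
      ∑ i, ∑ i', x i * x i' *
        ∫ y, ∑ j, ⟪Torus.partialDeriv j (b i) y, Torus.partialDeriv j (b i') y⟫_ℝ := by
  have hcont : ∀ i i', Continuous fun y => ∑ j : Fin 3,
      ⟪Torus.partialDeriv j (b i) y, Torus.partialDeriv j (b i') y⟫_ℝ := fun i i' =>
    continuous_finsetSum _ fun j _ =>
      ((hb i).partialDeriv j).continuous.inner ((hb i').partialDeriv j).continuous
  have hint : ∀ i i', Integrable (fun y => ∑ j : Fin 3,
      ⟪Torus.partialDeriv j (b i) y, Torus.partialDeriv j (b i') y⟫_ℝ) volume := fun i i' =>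
    (hcont i i').integrable_unitAddTorus
  -- pointwise expansion of the integrand
  have hpt : ∀ y, ∑ j, ‖Torus.partialDeriv j (fun z => ∑ i, x i • b i z) y‖ ^ 2 =
      ∑ i, ∑ i', x i * x i' * ∑ j, ⟪Torus.partialDeriv j (b i) y, Torus.partialDeriv j (b i') y⟫_ℝ := by
    intro y
    simp_rw [partialDeriv_sum_smul hb x, ← real_inner_self_eq_norm_sq, sum_inner, inner_sum,
      real_inner_smul_left, real_inner_smul_right, Finset.mul_sum]
    rw [Finset.sum_comm]
    refine Finset.sum_congr rfl fun i _ => ?_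
    rw [Finset.sum_comm]
    refine Finset.sum_congr rfl fun i' _ => Finset.sum_congr rfl fun j _ => ?_
    ring
  unfold Torus.gradNormSq
  simp_rw [hpt]
  rw [integral_finsetSum _ fun i _ => integrable_finsetSum _ fun i' _ => (hint i i').const_mul _]
  refine Finset.sum_congr rfl fun i _ => ?_
  rw [integral_finsetSum _ fun i' _ => (hint i i').const_mul _]
  refine Finset.sum_congr rfl fun i' _ => ?_
  exact integral_const_mul _ _

/-- **Enstrophy polynomial.** For smooth fields `b₁,…,bₙ` on `T³` there is a polynomial `D` of
degree `≤ 2` with `‖∇v‖₂² = D(x)` (spectral enstrophy, as a real number) for every field `v`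
agreeing a.e. with `Σᵢ xᵢ bᵢ`. [folklore] -/
theorem exists_gradNormSq_poly :
    ∀ {n : ℕ} {b : Fin n → UnitAddTorus (Fin 3) → EuclideanSpace ℝ (Fin 3)},
      (∀ i, Torus.IsSmooth (b i)) → ∃ D : MvPolynomial (Fin n) ℝ, D.totalDegree ≤ 2 ∧
      ∀ (x : Fin n → ℝ) (v : UnitAddTorus (Fin 3) → EuclideanSpace ℝ (Fin 3)),
      (v =ᵐ[volume] fun y => ∑ i, x i • b i y) →
      (Torus.eGradNormSq v).toReal = MvPolynomial.eval x D := by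
  intro n b hb
  refine ⟨∑ i, ∑ i', C (∫ y, ∑ j, ⟪Torus.partialDeriv j (b i) y, Torus.partialDeriv j (b i') y⟫_ℝ) *
    X i * X i', ?_, fun x v hv => ?_⟩
  · refine totalDegree_finsetSum_le fun i _ => totalDegree_finsetSum_le fun i' _ => ?_
    refine (totalDegree_mul _ _).trans ?_
    refine (add_le_add ((totalDegree_mul _ _).trans (add_le_add (totalDegree_C _).le
      (totalDegree_X (R := ℝ) i).le)) (totalDegree_X (R := ℝ) i').le).trans ?_
    norm_num
  · have hsm : Torus.IsSmooth (fun y => ∑ i, x i • b i y) := Torus.isSmooth_sum_smul _ _ fun i _ => hb i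
    rw [eGradNormSq_congr_ae hv, Torus.eGradNormSq_eq_ofReal_gradNormSq hsm,
      ENNReal.toReal_ofReal (Torus.gradNormSq_nonneg _), gradNormSq_sum_smul hb x]
    simp only [map_sum, map_mul, eval_C, eval_X]
    refine Finset.sum_congr rfl fun i _ => Finset.sum_congr rfl fun i' _ => ?_
    ring

end Summit.AnomalousDissipation.AnomalousDissipation.Theorems.MomentParityQuarticGate
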